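/-
Copyright (c) 2026. All rights reserved.
Released under Apache 2.0 license as described in the file LICENSE.
-/
import Literature.MathematicalPhysics.QuantumLattice.HubbardTorus2DEnergyDensity
import Literature.MathematicalPhysics.QuantumLattice.HubbardWave0LiebProofs
import HarnessLib

/-!
# Double occupancy as a supergradient of the ground-state energy in `U`

Topic `MathematicalPhysics/QuantumLattice`, family `hubbard`. For the Hubbard Hamiltonian
`H(t,U) = T + U D`, `D = Σ_x n_{x↑} n_{x↓}` (total double occupancy), on any finite graph and in
any particle-number sector `N`, the map `U ↦ E_N(U) = groundEnergyAt G t U N` is a minimum of affine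
functions, hence CONCAVE, and the double occupancy of a ground state is a supergradient:
for every normalised `N`-particle ground state `ψ` of `H(t,U)` and every `U'`,

  `E_N(U') - E_N(U) ≤ (U' - U) ⟨ψ, D ψ⟩`

(the ground state at `U` is a trial state at `U'`; the finite-volume content of the
Hellmann–Feynman relation `⟨D⟩ = ∂E/∂U`). Consequences proved here:

* `re_expect_hamiltonian_eq` — `Re⟨ψ,H(t,U')ψ⟩ = Re⟨ψ,H(t,U)ψ⟩ + (U' - U) Re⟨ψ,Dψ⟩`;
* `groundEnergyAt_sub_le_of_expect_le` — the inequality for an `η`-approximate ground state;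
* `groundEnergyAt_sub_le_mul_doubleOcc` — the supergradient inequality for ground states;
* `doubleOcc_mem_Icc_slope` — the slope sandwich
  `(E_N(U+ε) - E_N(U))/ε ≤ ⟨D⟩_ψ ≤ (E_N(U) - E_N(U-ε))/ε`;
* `doubleOcc_mem_Icc_of_bounds` — the CERTIFIED-BRACKET form: lower/upper energy bounds
  `L₂ ≤ E_N(U₂)`, `E_N(U) ≤ R`, `L₁ ≤ E_N(U₁)` at `U₁ < U < U₂` give
  `(L₂ - R)/(U₂ - U) ≤ ⟨D⟩_ψ ≤ (R - L₁)/(U - U₁)`;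
* `concaveOn_groundEnergyAt` — `U ↦ E_N(U)` is concave on `ℝ` (no ground state needed);
* thermodynamic limit on the square lattice (`energyDensity2D`, the limit along the tori
  `(ℤ/Lℤ)²`, `ThermodynamicLimit.tendsto_energyDensity2D_torus`): `concaveOn_energyDensity2D` —
  `U ↦ e(t,U,n)` is concave on `[0,∞)`; `energyDensity2D_sub_le_mul_of_tendsto` — every limit point
  `D∞` of ground-state double-occupancy DENSITIES `⟨D⟩_{ψ_L}/L²` along tori `L → ∞` satisfies
  `e(t,U',n) - e(t,U,n) ≤ (U' - U) D∞` for all `U' ≥ 0` (so certified two-sided bounds on `e` at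
  three couplings bracket any such `D∞`, `energyDensity2D_doubleOcc_mem_Icc_of_bounds`).

These are the statements behind "certified concavity brackets" on the double occupancy /
interaction energy `P = U⟨D⟩` / kinetic energy `K = E - P` obtained from certified energy
intervals. Everything is proved; no definition and no named fact is introduced (the operator is
written `∑ x, numberOp x 0 * numberOp x 1` as in `HubbardWave0.hamiltonian`; compare the
grand-canonical `μ`-versions `sub_mul_gcNumber_le`, `concaveOn_groundEnergy_hamiltonianWith` of
`HubbardGrandCanonicalDensity`).

## Mathlib / tree search

Tree (REUSED): `hamiltonian`, `numberOp`, `expect`, `IsNParticle`, `IsGroundState`, `groundEnergy`,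
`groundEnergyAt`, `LiebThm1.groundEnergy_le_re_expect`, `LiebThm1.bddBelow_energySet`,
`energyDensity2D`, `ThermodynamicLimit.rectN`, `ThermodynamicLimit.tendsto_energyDensity2D_torus`.
`lean search 'concaveOn_groundEnergyAt|doubleOcc|Hellmann'`: only the grand-canonical `μ`-versions
(`HubbardGrandCanonicalDensity`), nothing for the canonical `U`-direction.
Mathlib: `ConcaveOn`, `le_csInf`, `Real.sInf_empty`, `le_of_tendsto_of_tendsto'`.

## References

* R. B. Griffiths, J. Math. Phys. 5 (1964) 1215 (ground-state energy concave in a coupling;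
  one-sided derivatives bracket order parameters). [folklore]
* T. Koma, H. Tasaki, J. Stat. Phys. 76 (1994) 745, §1. [cite: KomaTasaki1994, §1]
* D. Ruelle, *Statistical Mechanics: Rigorous Results* (1969), convexity of thermodynamic
  functions. [folklore]
-/

noncomputable section

namespace Literature.MathematicalPhysics.QuantumLattice

namespace DoubleOccupancy

open Matrix Finset Filter Topology Literature.Probability.LatticeModels ThermodynamicLimit
open scoped ComplexOrder Topology

/-! ### Finite volume: any graph, any sector -/

section Finite

variable {Λ : Type*} [LinearOrder Λ] [Fintype Λ] (G : SimpleGraph Λ) [DecidableRel G.Adj]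

/-- `H(t,U') = H(t,U) + (U' - U) Σ_x n_{x↑} n_{x↓}` (`H` is affine in `U`). [folklore] -/
theorem hamiltonian_eq_add_smul (t U U' : ℝ) :
    hamiltonian G t U' =
      hamiltonian G t U + ((U' - U : ℝ) : ℂ) • ∑ x : Λ, numberOp x 0 * numberOp x 1 := by
  simp only [hamiltonian, Complex.ofReal_sub, sub_smul]
  abel

/-- `Re⟨ψ, H(t,U')ψ⟩ = Re⟨ψ, H(t,U)ψ⟩ + (U' - U) Re⟨ψ, Dψ⟩`. [folklore] -/
theorem re_expect_hamiltonian_eq (t U U' : ℝ) (ψ : Fock (Orb Λ)) :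
    (expect (hamiltonian G t U') ψ).re =
      (expect (hamiltonian G t U) ψ).re +
        (U' - U) * (expect (∑ x : Λ, numberOp x 0 * numberOp x 1) ψ).re := by
  have hadd : ∀ A B : Matrix (Finset (Orb Λ)) (Finset (Orb Λ)) ℂ,
      expect (A + B) ψ = expect A ψ + expect B ψ := fun A B => by
    simp [expect, add_mulVec, dotProduct_add]
  have hsmul : ∀ (c : ℂ) (A : Matrix (Finset (Orb Λ)) (Finset (Orb Λ)) ℂ),
      expect (c • A) ψ = c * expect A ψ := fun c A => by
    simp [expect, smul_mulVec, dotProduct_smul]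
  rw [hamiltonian_eq_add_smul G t U U', hadd, hsmul, Complex.add_re, Complex.re_ofReal_mul]

/-- **Trial-state inequality**: if a unit `N`-particle vector `ψ` has energy within `η` of
`E_N(U)`, then `E_N(U') - E_N(U) ≤ (U' - U)⟨ψ,Dψ⟩ + η` for every `U'`. [folklore] -/
theorem groundEnergyAt_sub_le_of_expect_le (t U U' : ℝ) {N : ℕ} {ψ : Fock (Orb Λ)}
    (hN : IsNParticle N ψ) (hψ1 : star ψ ⬝ᵥ ψ = 1) {η : ℝ}
    (hE : (expect (hamiltonian G t U) ψ).re ≤ groundEnergyAt G t U N + η) :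
    groundEnergyAt G t U' N - groundEnergyAt G t U N ≤
      (U' - U) * (expect (∑ x : Λ, numberOp x 0 * numberOp x 1) ψ).re + η := by
  have h := LiebThm1.groundEnergy_le_re_expect (hamiltonian G t U') hN hψ1
  rw [re_expect_hamiltonian_eq G t U U'] at h
  unfold groundEnergyAt at hE ⊢
  linarith

/-- The energy of a normalised ground state is `E_N(U)`. [folklore] -/
theorem re_expect_of_isGroundState (t U : ℝ) {N : ℕ} {ψ : Fock (Orb Λ)}
    (hψ : IsGroundState (hamiltonian G t U) N ψ) (hψ1 : star ψ ⬝ᵥ ψ = 1) :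
    (expect (hamiltonian G t U) ψ).re = groundEnergyAt G t U N := by
  rw [expect, hψ.2.2, dotProduct_smul, hψ1, smul_eq_mul, mul_one, Complex.ofReal_re,
    groundEnergyAt]

/-- **The double occupancy of a ground state is a supergradient of `U ↦ E_N(U)`**: for every
normalised `N`-particle ground state `ψ` of `H(t,U)` and every `U'`,
`E_N(U') - E_N(U) ≤ (U' - U) ⟨ψ, Σ_x n_{x↑}n_{x↓} ψ⟩`. [cite: KomaTasaki1994, §1] -/
theorem groundEnergyAt_sub_le_mul_doubleOcc (t U U' : ℝ) {N : ℕ} {ψ : Fock (Orb Λ)}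
    (hψ : IsGroundState (hamiltonian G t U) N ψ) (hψ1 : star ψ ⬝ᵥ ψ = 1) :
    groundEnergyAt G t U' N - groundEnergyAt G t U N ≤
      (U' - U) * (expect (∑ x : Λ, numberOp x 0 * numberOp x 1) ψ).re := by
  have h := groundEnergyAt_sub_le_of_expect_le G t U U' hψ.1 hψ1 (η := 0)
    (by rw [re_expect_of_isGroundState G t U hψ hψ1, add_zero])
  linarith

/-- **Slope sandwich**: for a normalised ground state `ψ` of `H(t,U)` and `ε > 0`,
`(E_N(U+ε) - E_N(U))/ε ≤ ⟨D⟩_ψ ≤ (E_N(U) - E_N(U-ε))/ε`. [cite: KomaTasaki1994, §1] -/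
theorem doubleOcc_mem_Icc_slope (t U : ℝ) {N : ℕ} {ψ : Fock (Orb Λ)}
    (hψ : IsGroundState (hamiltonian G t U) N ψ) (hψ1 : star ψ ⬝ᵥ ψ = 1) {ε : ℝ} (hε : 0 < ε) :
    (expect (∑ x : Λ, numberOp x 0 * numberOp x 1) ψ).re ∈
      Set.Icc ((groundEnergyAt G t (U + ε) N - groundEnergyAt G t U N) / ε)
        ((groundEnergyAt G t U N - groundEnergyAt G t (U - ε) N) / ε) := by
  have h1 := groundEnergyAt_sub_le_mul_doubleOcc G t U (U + ε) hψ hψ1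
  have h2 := groundEnergyAt_sub_le_mul_doubleOcc G t U (U - ε) hψ hψ1
  rw [add_sub_cancel_left] at h1
  rw [sub_sub_cancel_left, neg_mul] at h2
  constructor
  · rw [div_le_iff₀ hε, mul_comm]
    exact h1
  · rw [le_div_iff₀ hε, mul_comm]
    linarith

/-- **Certified bracket**: if `U₁ < U < U₂`, `L₁ ≤ E_N(U₁)`, `E_N(U) ≤ R` and `L₂ ≤ E_N(U₂)`
(e.g. certified lower/upper energy bounds), then every normalised ground state `ψ` of `H(t,U)`
has `(L₂ - R)/(U₂ - U) ≤ ⟨D⟩_ψ ≤ (R - L₁)/(U - U₁)`. [folklore] -/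
theorem doubleOcc_mem_Icc_of_bounds (t U : ℝ) {N : ℕ} {ψ : Fock (Orb Λ)}
    (hψ : IsGroundState (hamiltonian G t U) N ψ) (hψ1 : star ψ ⬝ᵥ ψ = 1)
    {U₁ U₂ L₁ R L₂ : ℝ} (hU₁ : U₁ < U) (hU₂ : U < U₂)
    (hL₁ : L₁ ≤ groundEnergyAt G t U₁ N) (hR : groundEnergyAt G t U N ≤ R)
    (hL₂ : L₂ ≤ groundEnergyAt G t U₂ N) :
    (expect (∑ x : Λ, numberOp x 0 * numberOp x 1) ψ).re ∈
      Set.Icc ((L₂ - R) / (U₂ - U)) ((R - L₁) / (U - U₁)) := by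
  have h1 := groundEnergyAt_sub_le_mul_doubleOcc G t U U₂ hψ hψ1
  have h2 := groundEnergyAt_sub_le_mul_doubleOcc G t U U₁ hψ hψ1
  have hd₂ : 0 < U₂ - U := sub_pos.2 hU₂
  have hd₁ : 0 < U - U₁ := sub_pos.2 hU₁
  constructor
  · rw [div_le_iff₀ hd₂, mul_comm]
    linarith
  · rw [le_div_iff₀ hd₁, mul_comm]
    nlinarith

/-- **`U ↦ E_N(U)` is concave on `ℝ`** (an infimum of the affine functions
`U ↦ Re⟨ψ, H(t,U) ψ⟩` over unit `N`-particle vectors; no ground state is needed, and for the empty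
sector `N > 2|Λ|` all values are the junk `sInf ∅ = 0`). [folklore] -/
theorem concaveOn_groundEnergyAt (t : ℝ) (N : ℕ) :
    ConcaveOn ℝ Set.univ fun U : ℝ => groundEnergyAt G t U N := by
  refine ⟨convex_univ, fun x _ y _ p q hp hq hpq => ?_⟩
  simp only [smul_eq_mul]
  by_cases hne : ∃ ψ : Fock (Orb Λ), IsNParticle N ψ ∧ star ψ ⬝ᵥ ψ = 1
  · obtain ⟨ψ₀, hN₀, h₀⟩ := hne
    have hS : groundEnergyAt G t (p * x + q * y) N =
        sInf {E : ℝ | ∃ ψ : Fock (Orb Λ), IsNParticle N ψ ∧ star ψ ⬝ᵥ ψ = 1 ∧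
          E = (expect (hamiltonian G t (p * x + q * y)) ψ).re} := rfl
    rw [hS]
    refine le_csInf ⟨_, ψ₀, hN₀, h₀, rfl⟩ ?_
    rintro b ⟨ψ, hN, h1, rfl⟩
    have hx : groundEnergyAt G t x N ≤ (expect (hamiltonian G t x) ψ).re :=
      LiebThm1.groundEnergy_le_re_expect (hamiltonian G t x) hN h1
    have hy : groundEnergyAt G t y N ≤ (expect (hamiltonian G t y) ψ).re :=
      LiebThm1.groundEnergy_le_re_expect (hamiltonian G t y) hN h1
    rw [re_expect_hamiltonian_eq G t x (p * x + q * y) ψ]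
    rw [re_expect_hamiltonian_eq G t x y ψ] at hy
    have hq' : q = 1 - p := by linarith
    subst hq'
    nlinarith [mul_le_mul_of_nonneg_left hx hp, mul_le_mul_of_nonneg_left hy hq]
  · -- no unit `N`-particle vector: all sector energies are the junk value `sInf ∅ = 0`
    have h0 : ∀ U : ℝ, groundEnergyAt G t U N = 0 := by
      intro U
      have hS : {E : ℝ | ∃ ψ : Fock (Orb Λ), IsNParticle N ψ ∧ star ψ ⬝ᵥ ψ = 1 ∧
          E = (expect (hamiltonian G t U) ψ).re} = ∅ :=
        Set.eq_empty_iff_forall_notMem.2 (by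
          rintro b ⟨ψ, hN, h1, -⟩
          exact hne ⟨ψ, hN, h1⟩)
      show sInf _ = 0
      rw [hS, Real.sInf_empty]
    simp [h0]

end Finite

/-! ### Thermodynamic limit on the square lattice -/

section Thermodynamic

/-- **`U ↦ e(t,U,n)` is concave on `[0,∞)`** (`0 ≤ n < 2`): the pointwise limit of the concave
functions `U ↦ E_{L×L}(N_L)/L²`. [folklore] -/
theorem concaveOn_energyDensity2D (t : ℝ) {n : ℝ} (hn0 : 0 ≤ n) (hn2 : n < 2) :
    ConcaveOn ℝ (Set.Ici 0) fun U : ℝ => energyDensity2D t U n := by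
  refine ⟨convex_Ici 0, fun x hx y hy p q hp hq hpq => ?_⟩
  simp only [smul_eq_mul]
  have hx0 : 0 ≤ x := hx
  have hy0 : 0 ≤ y := hy
  have hz0 : 0 ≤ p * x + q * y := by positivity
  have limx := tendsto_energyDensity2D_torus t hx0 hn0 hn2
  have limy := tendsto_energyDensity2D_torus t hy0 hn0 hn2
  have limz := tendsto_energyDensity2D_torus t hz0 hn0 hn2
  refine le_of_tendsto_of_tendsto' ((limx.const_mul p).add (limy.const_mul q)) limz fun L => ?_
  have hL := (concaveOn_groundEnergyAt (fermionTorusGraph 2 L) t (rectN n L)).2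
    (Set.mem_univ x) (Set.mem_univ y) hp hq hpq
  simp only [smul_eq_mul] at hL
  have hL2 : (0 : ℝ) ≤ (L : ℝ) ^ 2 := sq_nonneg _
  calc p * (groundEnergyAt (fermionTorusGraph 2 L) t x (rectN n L) / (L : ℝ) ^ 2) +
        q * (groundEnergyAt (fermionTorusGraph 2 L) t y (rectN n L) / (L : ℝ) ^ 2)
      = (p * groundEnergyAt (fermionTorusGraph 2 L) t x (rectN n L) +
          q * groundEnergyAt (fermionTorusGraph 2 L) t y (rectN n L)) / (L : ℝ) ^ 2 := by ring
    _ ≤ groundEnergyAt (fermionTorusGraph 2 L) t (p * x + q * y) (rectN n L) / (L : ℝ) ^ 2 :=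
        div_le_div_of_nonneg_right hL hL2

/-- **Supergradient inequality in the thermodynamic limit.** Let `0 ≤ n < 2`, `U, U' ≥ 0`, and let
`ψ_m` be normalised ground states of `H(t,U)` on the tori `(ℤ/L_mℤ)²`, `L_m → ∞`, in the sectors
`N = N_{L_m}(n)`, whose double-occupancy densities `⟨ψ_m, D ψ_m⟩/L_m²` converge to `D∞`. Then
`e(t,U',n) - e(t,U,n) ≤ (U' - U) D∞`. [cite: KomaTasaki1994, §1] -/
theorem energyDensity2D_sub_le_mul_of_tendsto (t : ℝ) {U U' : ℝ} (hU : 0 ≤ U) (hU' : 0 ≤ U')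
    {n : ℝ} (hn0 : 0 ≤ n) (hn2 : n < 2) {φ : ℕ → ℕ} (hφ : Tendsto φ atTop atTop)
    {ψ : ∀ m : ℕ, Fock (Orb (FermionTorus 2 (φ m)))}
    (hψ : ∀ m, IsGroundState (hamiltonian (fermionTorusGraph 2 (φ m)) t U) (rectN n (φ m)) (ψ m))
    (hψ1 : ∀ m, star (ψ m) ⬝ᵥ ψ m = 1) {D : ℝ}
    (hD : Tendsto (fun m => (expect (∑ x : FermionTorus 2 (φ m), numberOp x 0 * numberOp x 1)
      (ψ m)).re / ((φ m : ℕ) : ℝ) ^ 2) atTop (𝓝 D)) :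
    energyDensity2D t U' n - energyDensity2D t U n ≤ (U' - U) * D := by
  have limU := (tendsto_energyDensity2D_torus t hU hn0 hn2).comp hφ
  have limU' := (tendsto_energyDensity2D_torus t hU' hn0 hn2).comp hφ
  refine le_of_tendsto_of_tendsto' (limU'.sub limU) (hD.const_mul (U' - U)) fun m => ?_
  simp only [Function.comp_apply]
  have h := groundEnergyAt_sub_le_mul_doubleOcc (fermionTorusGraph 2 (φ m)) t U U' (hψ m) (hψ1 m)
  have hL2 : (0 : ℝ) ≤ ((φ m : ℕ) : ℝ) ^ 2 := sq_nonneg _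
  rw [← sub_div, ← mul_div_assoc]
  exact div_le_div_of_nonneg_right h hL2

/-- **Certified bracket in the thermodynamic limit**: with `D∞` as above at coupling `U`, and
certified bounds `l₂ ≤ e(U₂)`, `e(U) ≤ r`, `l₁ ≤ e(U₁)` at `0 ≤ U₁ < U < U₂`:
`(l₂ - r)/(U₂ - U) ≤ D∞ ≤ (r - l₁)/(U - U₁)`. [folklore] -/
theorem energyDensity2D_doubleOcc_mem_Icc_of_bounds (t : ℝ) {U : ℝ} {n : ℝ} (hn0 : 0 ≤ n)
    (hn2 : n < 2) {φ : ℕ → ℕ} (hφ : Tendsto φ atTop atTop)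
    {ψ : ∀ m : ℕ, Fock (Orb (FermionTorus 2 (φ m)))}
    (hψ : ∀ m, IsGroundState (hamiltonian (fermionTorusGraph 2 (φ m)) t U) (rectN n (φ m)) (ψ m))
    (hψ1 : ∀ m, star (ψ m) ⬝ᵥ ψ m = 1) {D : ℝ}
    (hD : Tendsto (fun m => (expect (∑ x : FermionTorus 2 (φ m), numberOp x 0 * numberOp x 1)
      (ψ m)).re / ((φ m : ℕ) : ℝ) ^ 2) atTop (𝓝 D))
    {U₁ U₂ l₁ r l₂ : ℝ} (hU₁0 : 0 ≤ U₁) (hU₁ : U₁ < U) (hU₂ : U < U₂)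
    (hl₁ : l₁ ≤ energyDensity2D t U₁ n) (hr : energyDensity2D t U n ≤ r)
    (hl₂ : l₂ ≤ energyDensity2D t U₂ n) :
    D ∈ Set.Icc ((l₂ - r) / (U₂ - U)) ((r - l₁) / (U - U₁)) := by
  have hU : 0 ≤ U := hU₁0.trans hU₁.le
  have h1 := energyDensity2D_sub_le_mul_of_tendsto t hU (hU.trans hU₂.le) hn0 hn2 hφ hψ hψ1 hD
  have h2 := energyDensity2D_sub_le_mul_of_tendsto t hU hU₁0 hn0 hn2 hφ hψ hψ1 hD
  have hd₂ : 0 < U₂ - U := sub_pos.2 hU₂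
  have hd₁ : 0 < U - U₁ := sub_pos.2 hU₁
  constructor
  · rw [div_le_iff₀ hd₂, mul_comm]
    linarith
  · rw [le_div_iff₀ hd₁, mul_comm]
    nlinarith

end Thermodynamic

end DoubleOccupancy

end Literature.MathematicalPhysics.QuantumLattice
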